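import Mathlib
import Literature.Analysis.FunctionSpaces.TorusFourierModes
import Literature.Analysis.FunctionSpaces.TorusFourierCalculus
import Literature.Analysis.FunctionSpaces.TorusEnstrophyOrthogonality

/-!
# Phantom floor law — support III: pairings

Support for `Theorems/TaylorCertificatesPhantomFloorLaw.lean` (stmt-AnomalousDissipation-14033). Cauchy–Schwarz for
the `L²` pairing of fields on `T³`; Green's first identity in vector form and the bound
`|∫ ⟪a, ΔW⟫| ≤ ‖∇a‖₂ ‖∇W‖₂`; measurability and integrability of the inertial integrand `⟪DW(x) g(x), g(x)⟫` of an
`L²` field `g` against a smooth multiplier `W`.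
-/

noncomputable section

-- `Summit.<Summit>.<Sub>` repeats `AnomalousDissipation` by the tree's layout (D-0017), as in the sibling files.
set_option linter.dupNamespace false

open MeasureTheory Filter Topology UnitAddTorus
open scoped InnerProductSpace ENNReal

namespace Summit.AnomalousDissipation.AnomalousDissipation.Theorems.PhantomFloor

open Literature.Analysis.FunctionSpaces

/-! ## Cauchy–Schwarz for the `L²` pairing -/

/-- **Cauchy–Schwarz**: `|∫ ⟪h, f⟫| ≤ (∫‖h‖²)^{1/2} (∫‖f‖²)^{1/2}` for `h, f ∈ L²(T³; ℝ³)`. -/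
theorem abs_integral_inner_le {h f : (UnitAddTorus (Fin 3)) → (EuclideanSpace ℝ (Fin 3))} (hh : MemLp h 2 volume) (hf : MemLp f 2 volume) :
    |∫ x, ⟪h x, f x⟫_ℝ| ≤ Real.sqrt (∫ x, ‖h x‖ ^ 2) * Real.sqrt (∫ x, ‖f x‖ ^ 2) := by
  have h1 : ⟪hh.toLp h, hf.toLp f⟫_ℝ = ∫ x, ⟪h x, f x⟫_ℝ := by
    rw [MeasureTheory.L2.inner_def]
    refine integral_congr_ae ?_
    filter_upwards [hh.coeFn_toLp, hf.coeFn_toLp] with x hx hx'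
    rw [hx, hx']
  have hn : ∀ {g : (UnitAddTorus (Fin 3)) → (EuclideanSpace ℝ (Fin 3))} (hg : MemLp g 2 volume), ‖hg.toLp g‖ ^ 2 = ∫ x, ‖g x‖ ^ 2 := by
    intro g hg
    rw [← real_inner_self_eq_norm_sq, MeasureTheory.L2.inner_def]
    refine integral_congr_ae ?_
    filter_upwards [hg.coeFn_toLp] with x hx
    rw [hx, real_inner_self_eq_norm_sq]
  rw [← h1]
  have := abs_real_inner_le_norm (hh.toLp h) (hf.toLp f)
  rwa [← Real.sqrt_sq (norm_nonneg (hh.toLp h)), ← Real.sqrt_sq (norm_nonneg (hf.toLp f)),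
    hn hh, hn hf] at this

/-! ## Green's identity and the Laplacian pairing -/

/-- **Green's first identity, vector form**: `∫ ⟪a, ΔW⟫ = -∑ᵢ ∫ ⟪∂ᵢa, ∂ᵢW⟫` for smooth `a`, `W`. -/
theorem integral_inner_laplacian_eq_neg_sum {a W : (UnitAddTorus (Fin 3)) → (EuclideanSpace ℝ (Fin 3))} (ha : Torus.IsSmooth a) (hW : Torus.IsSmooth W) :
    ∫ x, ⟪a x, Torus.laplacian W x⟫_ℝ = -∑ i, ∫ x, ⟪Torus.partialDeriv i a x, Torus.partialDeriv i W x⟫_ℝ := by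
  have ha1 : Torus.IsContDiff 1 a := ha.isContDiff (by simp)
  have hW1 : ∀ i, Torus.IsContDiff 1 (Torus.partialDeriv i W) := fun i => (hW.partialDeriv i).isContDiff (by simp)
  have hpt : ∀ x, ⟪a x, Torus.laplacian W x⟫_ℝ = ∑ i,
      (Torus.partialDeriv i (fun y => ⟪a y, Torus.partialDeriv i W y⟫_ℝ) x -
        ⟪Torus.partialDeriv i a x, Torus.partialDeriv i W x⟫_ℝ) := by
    intro x
    rw [Torus.laplacian_eq_sum_partialDeriv_partialDeriv hW, inner_sum]
    refine Finset.sum_congr rfl fun i _ => ?_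
    rw [Torus.partialDeriv_inner ha1 (hW1 i)]
    ring
  have hs : ∀ i, Torus.IsSmooth (fun y => ⟪a y, Torus.partialDeriv i W y⟫_ℝ) := fun i => ha.inner (hW.partialDeriv i)
  have hp : ∀ i, Torus.IsSmooth (fun y => ⟪Torus.partialDeriv i a y, Torus.partialDeriv i W y⟫_ℝ) := fun i =>
    (ha.partialDeriv i).inner (hW.partialDeriv i)
  simp_rw [hpt]
  rw [integral_finsetSum _ (f := fun i x => Torus.partialDeriv i (fun y => ⟪a y, Torus.partialDeriv i W y⟫_ℝ) x -
      ⟪Torus.partialDeriv i a x, Torus.partialDeriv i W x⟫_ℝ)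
      fun i _ => ((hs i).partialDeriv i).integrable.sub (hp i).integrable,
    ← Finset.sum_neg_distrib]
  refine Finset.sum_congr rfl fun i _ => ?_
  rw [integral_sub ((hs i).partialDeriv i).integrable (hp i).integrable,
    Torus.integral_partialDeriv_eq_zero_holds (hs i) i, zero_sub]

/-- **The Laplacian pairing is controlled by the two enstrophies**:
`|∫ ⟪a, ΔW⟫| ≤ ‖∇a‖₂ ‖∇W‖₂` for smooth `a`, `W`. -/
theorem abs_integral_inner_laplacian_le {a W : (UnitAddTorus (Fin 3)) → (EuclideanSpace ℝ (Fin 3))} (ha : Torus.IsSmooth a) (hW : Torus.IsSmooth W) :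
    |∫ x, ⟪a x, Torus.laplacian W x⟫_ℝ| ≤ Real.sqrt (Torus.gradNormSq a) * Real.sqrt (Torus.gradNormSq W) := by
  rw [integral_inner_laplacian_eq_neg_sum ha hW, abs_neg]
  have hterm : ∀ i, |∫ x, ⟪Torus.partialDeriv i a x, Torus.partialDeriv i W x⟫_ℝ| ≤
      Real.sqrt (∫ x, ‖Torus.partialDeriv i a x‖ ^ 2) * Real.sqrt (∫ x, ‖Torus.partialDeriv i W x‖ ^ 2) :=
    fun i => abs_integral_inner_le ((ha.partialDeriv i).memLp 2) ((hW.partialDeriv i).memLp 2)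
  refine (Finset.abs_sum_le_sum_abs _ _).trans ((Finset.sum_le_sum fun i _ => hterm i).trans ?_)
  refine (Real.sum_mul_le_sqrt_mul_sqrt _ _ _).trans (le_of_eq ?_)
  have e1 : ∀ (u : (UnitAddTorus (Fin 3)) → (EuclideanSpace ℝ (Fin 3))), Torus.IsSmooth u →
      ∑ i, Real.sqrt (∫ x, ‖Torus.partialDeriv i u x‖ ^ 2) ^ 2 = Torus.gradNormSq u := by
    intro u hu
    rw [Torus.gradNormSq, integral_finsetSum _ fun i _ => (hu.partialDeriv i).norm_sq.integrable]
    refine Finset.sum_congr rfl fun i _ => Real.sq_sqrt (integral_nonneg fun x => sq_nonneg _)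
  rw [e1 a ha, e1 W hW]

/-! ## The inertial quadratic form at an `L²` field -/

/-- A continuous real function on the torus is bounded above. -/
theorem exists_forall_le_of_continuous {φ : (UnitAddTorus (Fin 3)) → ℝ} (hφ : Continuous φ) : ∃ C : ℝ, ∀ x, φ x ≤ C := by
  obtain ⟨x₁, -, hx₁⟩ := isCompact_univ.exists_isMaxOn Set.univ_nonempty hφ.continuousOn
  exact ⟨φ x₁, fun x => hx₁ (Set.mem_univ x)⟩

/-- The inertial integrand `⟪DW(x) g(x), g(x)⟫` of an `L²` field `g` against a smooth multiplier `W` is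
a.e.-strongly measurable. -/
theorem aestronglyMeasurable_inertial {g : (UnitAddTorus (Fin 3)) → (EuclideanSpace ℝ (Fin 3))} (hg : AEStronglyMeasurable g volume) {W : (UnitAddTorus (Fin 3)) → (EuclideanSpace ℝ (Fin 3))}
    (hW : Torus.IsSmooth W) :
    AEStronglyMeasurable (fun x => ⟪Torus.fderiv W x (g x), g x⟫_ℝ) volume := by
  have hW1 : Torus.IsContDiff 1 W := hW.isContDiff (by simp)
  have h : (fun x => Torus.fderiv W x (g x)) = fun x => ∑ j, g x j • Torus.partialDeriv j W x := by
    funext x; exact Torus.fderiv_apply_eq_sum_partialDeriv hW1 x (g x)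
  refine AEStronglyMeasurable.inner ?_ hg
  rw [h]
  exact Finset.aestronglyMeasurable_sum (f := fun j x => g x j • Torus.partialDeriv j W x) Finset.univ
    fun j _ => ((EuclideanSpace.proj (𝕜 := ℝ) j).continuous.comp_aestronglyMeasurable hg).smul
      (hW.partialDeriv j).continuous.aestronglyMeasurable

/-- Uniform bound for the derivative of a smooth field: `‖DW(x) y‖ ≤ C ‖y‖`. -/
theorem exists_norm_fderiv_apply_le {W : (UnitAddTorus (Fin 3)) → (EuclideanSpace ℝ (Fin 3))} (hW : Torus.IsSmooth W) :
    ∃ C : ℝ, 0 ≤ C ∧ ∀ (x : (UnitAddTorus (Fin 3))) (y : (EuclideanSpace ℝ (Fin 3))), ‖Torus.fderiv W x y‖ ≤ C * ‖y‖ := by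
  have hW1 : Torus.IsContDiff 1 W := hW.isContDiff (by simp)
  have hc : Continuous fun x => ∑ i, ‖Torus.partialDeriv i W x‖ :=
    continuous_finsetSum _ fun i _ => (hW.partialDeriv i).continuous.norm
  obtain ⟨C, hC⟩ := exists_forall_le_of_continuous hc
  have hC0 : 0 ≤ C := (Finset.sum_nonneg fun i _ => norm_nonneg _).trans (hC 0)
  refine ⟨C, hC0, fun x y => ?_⟩
  rw [mul_comm]
  exact (Torus.norm_fderiv_apply_le hW1 x y).trans (mul_le_mul_of_nonneg_left (hC x) (norm_nonneg _))

/-- **The inertial integrand of an `L²` field is integrable**: `x ↦ ⟪DW(x) g(x), g(x)⟫ ∈ L¹`. -/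
theorem integrable_inertial {g : (UnitAddTorus (Fin 3)) → (EuclideanSpace ℝ (Fin 3))} (hg : MemLp g 2 volume) {W : (UnitAddTorus (Fin 3)) → (EuclideanSpace ℝ (Fin 3))} (hW : Torus.IsSmooth W) :
    Integrable (fun x => ⟪Torus.fderiv W x (g x), g x⟫_ℝ) volume := by
  obtain ⟨C, -, hC⟩ := exists_norm_fderiv_apply_le hW
  refine Integrable.mono' ((hg.integrable_norm_pow two_ne_zero).const_mul C)
    (aestronglyMeasurable_inertial hg.1 hW) (Eventually.of_forall fun x => ?_)
  rw [Real.norm_eq_abs]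
  calc |⟪Torus.fderiv W x (g x), g x⟫_ℝ| ≤ ‖Torus.fderiv W x (g x)‖ * ‖g x‖ := abs_real_inner_le_norm _ _
    _ ≤ C * ‖g x‖ * ‖g x‖ := mul_le_mul_of_nonneg_right (hC x (g x)) (norm_nonneg _)
    _ = C * ‖g x‖ ^ 2 := by ring

end Summit.AnomalousDissipation.AnomalousDissipation.Theorems.PhantomFloor
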